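import Literature.Computability.Complexity.PEASigmaTwoCriterion
import Literature.Computability.Complexity.PEASigmaTwoSemantics
import Literature.Computability.Complexity.PEASigmaTwoFP
import Literature.Computability.Complexity.PolyHierarchy
import Literature.Computability.Complexity.KarpLipton
import Literature.Computability.Complexity.LengthCompare
import HarnessLib

/-!
# Entropy approximation for explicit maps over `F₂` is in `promise-Σ₂ᵖ`

Main file of the series `PEASigmaTwo*.lean`: for every degree bound `d`, the promise problem
`PEA d` of Dvir–Gutfreund–Rothblum–Vadhan (`PolynomialEntropyApproximation.lean`: given a sparse
polynomial map `p : F₂ⁿ → F₂^m` and `k`, is `H(p(U_n)) ≥ k + 1` or `≤ k`?) is separated by a language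
of `Σ₂ᵖ`:

* **`PEA_mem_promiseLift_SigmaP_two : PEA d ∈ promiseLift (SigmaP 2)`**, and hence
  `PEA_mem_promiseLift_PH : PEA d ∈ promiseLift PH`.

The separating language is `L₂ = {z | ∃ h, |h| ≤ B(|z|) ∧ ∀ v, |v| ≤ B → ∀ u, |u| ≤ B → Mat ⟨⟨⟨z,h⟩,v⟩,u⟩}`
with `Mat ∈ P` the language of the program `PEAHash.matP` (`matPFP`), i.e. "the `t`-fold power of the
`NP`-set `S` of the instance is hashable at level `κ`" (Sipser's Coding Lemma; semantics:
`PEASigmaTwoSemantics.lean`; the criterion that this holds on YES instances and fails on NO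
instances: `PEASigmaTwoCriterion.lean`).  The degree bound `d` plays no role.  In print the upper
bound `EA ∈ AM ∩ coAM ⊆ Π₂ᵖ ∩ Σ₂ᵖ` for entropy approximation of samplable distributions is obtained
through `NISZK` (Goldreich–Sahai–Vadhan 1999); the present proof is the direct hashing argument.

Also: the polynomial `(49152 X⁶ + 6)⁶` dominating the lengths of the quantified strings, `nVars_le_length`
(the number of used variables is at most the length of the instance code — the reason for the
renaming, since `n` itself is binary), `polyForall_PiP_one_subset`.

## References

* M. Sipser, *A complexity theoretic approach to randomness*, STOC 1983, §III, §V.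
* L. Stockmeyer, *On approximation algorithms for #P*, SIAM J. Comput. 14 (1985).
* O. Goldreich, A. Sahai, S. Vadhan, *Can statistical zero knowledge be made non-interactive?*,
  CRYPTO 1999.
* Z. Dvir, D. Gutfreund, G. N. Rothblum, S. Vadhan, ECCC TR10-160 (2010) / ICS 2011, §3, Thm 1.1.
* S. Arora, B. Barak, *Computational Complexity: A Modern Approach*, CUP 2009, Def. 5.3.
-/

namespace Literature.Computability.Complexity

open _root_.Computability Polynomial CodeFP SipserHash PostBPPHash Literature.InformationTheory.Entropy

namespace PEAHash

/-! ### Polynomial bounds -/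

section Bounds

/-- `M ≤ 49152 n'⁶`. [folklore] -/
theorem pM_le (n k : ℕ) : pM n k ≤ 49152 * n ^ 6 := by
  unfold pM pN pR pT
  rcases Nat.eq_zero_or_pos n with rfl | hn
  · simp
  have h3 : n ^ 3 ≤ n ^ 6 := Nat.pow_le_pow_right hn (by norm_num)
  have hR : 128 * n ^ 2 * (n - k) - 128 * n ^ 2 / 2 ≤ 128 * n ^ 3 := by
    calc 128 * n ^ 2 * (n - k) - 128 * n ^ 2 / 2 ≤ 128 * n ^ 2 * (n - k) := Nat.sub_le _ _
      _ ≤ 128 * n ^ 2 * n := Nat.mul_le_mul_left _ (Nat.sub_le _ _)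
      _ = 128 * n ^ 3 := by ring
  have hN : 128 * n ^ 2 * n = 128 * n ^ 3 := by ring
  rw [hN]
  set R := 128 * n ^ 2 * (n - k) - 128 * n ^ 2 / 2 with hRdef
  calc 128 * n ^ 3 + (R * (128 * n ^ 3) + R) ≤ 128 * n ^ 3 + (128 * n ^ 3 * (128 * n ^ 3) + 128 * n ^ 3) := by
        gcongr
    _ = 256 * n ^ 3 + 16384 * n ^ 6 := by ring
    _ ≤ 256 * n ^ 6 + 16384 * n ^ 6 := by gcongr
    _ ≤ 49152 * n ^ 6 := by omega

/-- Evaluation of the bounding polynomial `B(x) = (49152 x⁶ + 6)⁶`. [folklore] -/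
theorem boundPoly_eval (x : ℕ) : ((C 49152 * X ^ 6 + 6) ^ 6 : Polynomial ℕ).eval x = (49152 * x ^ 6 + 6) ^ 6 := by
  simp

/-- The three string lengths of the `Σ₂ᵖ` predicate are below `B(n')`: `κ² L`, `(κ+1) L`,
`(κ+1) t N`. [folklore] -/
theorem lengths_le_boundPoly (n k : ℕ) :
    pK n k * pK n k * pL n k ≤ ((C 49152 * X ^ 6 + 6) ^ 6 : Polynomial ℕ).eval n ∧
      (pK n k + 1) * pL n k ≤ ((C 49152 * X ^ 6 + 6) ^ 6 : Polynomial ℕ).eval n ∧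
      (pK n k + 1) * pt n k * pN n ≤ ((C 49152 * X ^ 6 + 6) ^ 6 : Polynomial ℕ).eval n := by
  rw [boundPoly_eval]
  set B := 49152 * n ^ 6 with hB
  have hM : pM n k ≤ B := pM_le n k
  have ht : pt n k ≤ B + 5 := by unfold pt; omega
  have hK : pK n k ≤ (B + 5) * (B + 5) := by
    unfold pK
    exact Nat.mul_le_mul ht ((Nat.sub_le _ _).trans (hM.trans (by omega)))
  have hL : pL n k ≤ (B + 5) * (B + 5) := Nat.mul_le_mul ht (hM.trans (by omega))
  have hN : pN n ≤ B + 5 := by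
    have : pN n ≤ pM n k := by unfold pM; omega
    omega
  refine ⟨?_, ?_, ?_⟩
  · calc pK n k * pK n k * pL n k ≤ ((B + 5) * (B + 5)) * ((B + 5) * (B + 5)) * ((B + 5) * (B + 5)) :=
          Nat.mul_le_mul (Nat.mul_le_mul hK hK) hL
      _ = (B + 5) ^ 6 := by ring
      _ ≤ (B + 6) ^ 6 := Nat.pow_le_pow_left (by omega) 6
  · calc (pK n k + 1) * pL n k ≤ ((B + 5) * (B + 5) + 1) * ((B + 5) * (B + 5)) :=
          Nat.mul_le_mul (by omega) hL
      _ ≤ ((B + 6) * (B + 6)) * ((B + 6) * (B + 6)) := Nat.mul_le_mul (by nlinarith) (by nlinarith)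
      _ = (B + 6) ^ 4 := by ring
      _ ≤ (B + 6) ^ 6 := Nat.pow_le_pow_right (by omega) (by norm_num)
  · calc (pK n k + 1) * pt n k * pN n ≤ ((B + 5) * (B + 5) + 1) * (B + 5) * (B + 5) :=
          Nat.mul_le_mul (Nat.mul_le_mul (by omega) ht) hN
      _ ≤ ((B + 6) * (B + 6)) * (B + 6) * (B + 6) :=
          Nat.mul_le_mul (Nat.mul_le_mul (by nlinarith) (by omega)) (by omega)
      _ = (B + 6) ^ 4 := by ring
      _ ≤ (B + 6) ^ 6 := Nat.pow_le_pow_right (by omega) (by norm_num)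

/-- A sum of item sizes is below the length of the raw code. [folklore] -/
theorem sum_le_length_rawE {α : Type} (e : α → List Bool) (f : α → ℕ) (hf : ∀ a, f a ≤ (e a).length) :
    ∀ l : List α, (l.map f).sum ≤ (rawE e l).length
  | [] => by simp
  | a :: l => by
    rw [List.map_cons, List.sum_cons, rawE_cons, length_boolPair]
    have := sum_le_length_rawE e f hf l
    have := hf a
    omega

/-- The raw code is at most as long as the headed code. [folklore] -/
theorem length_rawE_le_length_listE {α : Type} (e : α → List Bool) (l : List α) : (rawE e l).length ≤ (listE e l).length := by
  simp [listE, length_boolPair]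

/-- **The number of used variables is at most the length of the instance code** (every occurrence
of an index costs at least the two separator bits of its list cell). [folklore] -/
theorem nVars_le_length (I : PEAInst) : nVars (erase I).2.1 ≤ (PEAInst.encoding.encode I).length := by
  rw [encode_eq_shE]
  set P := (erase I).2.1 with hP
  have h1 : nVars P ≤ P.flatten.flatten.length := (List.dedup_sublist _).length_le
  have hf : ∀ p : List (List ℕ), (p.map List.length).sum ≤ (listE (listE natE) p).length := by
    intro p
    refine le_trans ?_ (length_rawE_le_length_listE _ _)
    refine sum_le_length_rawE (listE natE) List.length (fun μ => ?_) p
    exact (length_le_length_rawE natE μ).trans (length_rawE_le_length_listE _ _)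
  have h2 : P.flatten.flatten.length ≤ (listE (listE (listE natE)) P).length := by
    rw [List.length_flatten, List.map_flatten, List.sum_flatten, List.map_map]
    exact (sum_le_length_rawE (listE (listE natE)) (fun p => (p.map List.length).sum) hf P).trans
      (length_rawE_le_length_listE _ _)
  have h3 : (listE (listE (listE natE)) P).length ≤ (shE (erase I)).length := by
    simp only [shE, pairE_apply, length_boolPair, hP]
    omega
  exact h1.trans (h2.trans h3)

end Bounds

/-! ### A closure property of `Π₁ᵖ` -/

/-- `∀ᵖ · Π₁ᵖ ⊆ Π₁ᵖ` (merge the two universal strings; from the tree's `∃ᵖ · Σ₁ᵖ ⊆ Σ₁ᵖ` by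
complementation). [cite: AroraBarak2009, Def. 5.3 and Remark 5.8] -/
theorem polyForall_PiP_one_subset : polyForall (PiP 1) ⊆ PiP 1 := by
  intro L hL
  have h1 : polyForall (PiP 1) = co (polyExists (SigmaP 1)) := by
    rw [polyForall, PiP_eq_co, co_co]
  rw [h1] at hL
  rw [PiP_eq_co]
  exact co_mono (KarpLipton.polyExists_SigmaP_succ_subset 0) hL

/-! ### The theorem -/

/-- **Polynomial entropy approximation over `F₂` is in `promise-Σ₂ᵖ`**: for every degree bound `d`,
some language of `Σ₂ᵖ` contains every YES instance of `PEA d` (`H(p(U_n)) ≥ k + 1`) and no NO instance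
(`H(p(U_n)) ≤ k`).  The language: "some family of `κ` hash matrices separates the `t`-fold power of
the `NP`-set `S` of the (renamed) instance" (`PEASigmaTwoProgram.lean`), a `Σ₂ᵖ` predicate by
`matPFP`; correctness by `hashable_of_entropy_ge` / `not_hashable_of_entropy_le` and
`matCore_of_hashable` / `hashable_of_matCore`.  (In print: `EA ∈ NISZK ⊆ AM ∩ coAM ⊆ Σ₂ᵖ ∩ Π₂ᵖ`.)
[cite: Sipser1983, §V] [cite: GoldreichSahaiVadhan1999, Thm 1 (EA and NISZK ⊆ AM ∩ coAM)]
[cite: DvirGutfreundRothblumVadhan2010, §3 p.6] -/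
theorem PEA_mem_promiseLift_SigmaP_two (d : ℕ) : PEA d ∈ promiseLift (SigmaP 2) := by
  classical
  set boundPoly : Polynomial ℕ := (C 49152 * X ^ 6 + 6) ^ 6 with hbp
  -- the polynomial-time matrix
  obtain ⟨f₀, hf₀, hspec⟩ := matPFP
  set g : List Bool → List Bool := HashBricks.headBitFn ∘ f₀ with hg
  have hgFP : g ∈ FP := comp_mem_FP HashBricks.headBitFn_mem_FP hf₀
  have hframe : ∀ (I : PEAInst) (h v u : List Bool),
      g (boolPair (boolPair (boolPair (PEAInst.encoding.encode I) h) v) u) = [matP (erase I) h v u] := by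
    intro I h v u
    have key := hspec (((erase I, h), v), u)
    simp only [frameE, pairE_apply, strE, id_eq] at key
    rw [hg, Function.comp_apply, encode_eq_shE]
    simp only [shE, pairE_apply] at key ⊢
    rw [key, HashBricks.headBitFn_apply]
    rfl
  set Mat : Language Bool := {w | g w = [true]} with hMatdef
  have hMat : Mat ∈ Classes.P := by
    refine mem_P_of_mem_FP hgFP Mat fun w => ⟨fun hw => hw, fun hw => ?_⟩
    have hw' : g w ≠ [true] := hw
    have hone : g w = [(f₀ w).headD false] := by rw [hg, Function.comp_apply, HashBricks.headBitFn_apply]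
    rw [hone] at hw' ⊢
    cases hb : (f₀ w).headD false
    · rfl
    · rw [hb] at hw'
      exact absurd rfl hw'
  set B : Language Bool := {s | ∀ u : List Bool, u.length ≤ boundPoly.eval s.length → boolPair s u ∈ Mat} with hBdef
  set A : Language Bool := {s | ∀ v : List Bool, v.length ≤ boundPoly.eval s.length → boolPair s v ∈ B} with hAdef
  set L₂ : Language Bool := {z | ∃ h : List Bool, h.length ≤ boundPoly.eval z.length ∧ boolPair z h ∈ A} with hLdef
  have hB : B ∈ PiP 1 := by
    change B ∈ polyForall (SigmaP 0)
    exact mem_polyForall_iff.2 ⟨Mat, hMat, boundPoly, fun s => Iff.rfl⟩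
  have hA : A ∈ PiP 1 := polyForall_PiP_one_subset (mem_polyForall_iff.2 ⟨B, hB, boundPoly, fun s => Iff.rfl⟩)
  have hL₂ : L₂ ∈ SigmaP 2 := by
    change L₂ ∈ polyExists (PiP 1)
    exact ⟨A, hA, boundPoly, fun z => Iff.rfl⟩
  refine ⟨L₂, hL₂, ?_, ?_⟩
  · -- YES instances are in `L₂`
    rintro z ⟨I, hI, rfl⟩
    obtain ⟨-, hH⟩ := hI
    obtain ⟨hk, hHash⟩ := hashable_of_entropy_ge I hH
    obtain ⟨h, hlen, hall⟩ := matCore_of_hashable (rename (erase I).2.1) hk hHash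
    have hn := nVars_le_length I
    have hbnd := (lengths_le_boundPoly (nVars (erase I).2.1) I.2.2).1
    refine ⟨h, ?_, fun v _ u _ => ?_⟩
    · rw [hlen]
      exact hbnd.trans (TM2Iter.eval_mono boundPoly hn)
    · show g _ = [true]
      rw [hframe]
      exact congrArg (fun b => [b]) (hall v u)
  · -- NO instances are not in `L₂`
    rintro z ⟨I, hI, rfl⟩ ⟨h, -, hAll⟩
    obtain ⟨-, hH⟩ := hI
    have hmem : ∀ v u : List Bool, v.length ≤ boundPoly.eval (PEAInst.encoding.encode I).length →
        u.length ≤ boundPoly.eval (PEAInst.encoding.encode I).length → matP (erase I) h v u = true := by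
      intro v u hv hu
      have hv' : v.length ≤ boundPoly.eval (boolPair (PEAInst.encoding.encode I) h).length :=
        hv.trans (TM2Iter.eval_mono boundPoly (by rw [length_boolPair]; omega))
      have hu' : u.length ≤ boundPoly.eval (boolPair (boolPair (PEAInst.encoding.encode I) h) v).length :=
        hu.trans (TM2Iter.eval_mono boundPoly (by rw [length_boolPair, length_boolPair]; omega))
      have := hAll v hv' u hu'
      change g _ = [true] at this
      rw [hframe] at this
      simpa using this
    by_cases hk : I.2.2 < nVars (erase I).2.1
    · have hn := nVars_le_length I
      have hbnd := lengths_le_boundPoly (nVars (erase I).2.1) I.2.2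
      refine not_hashable_of_entropy_le I hH hk (hashable_of_matCore (rename (erase I).2.1) h fun v u hv hu => ?_)
      exact hmem v u (hv ▸ hbnd.2.1.trans (TM2Iter.eval_mono boundPoly hn))
        (hu ▸ hbnd.2.2.trans (TM2Iter.eval_mono boundPoly hn))
    · have := hmem [] [] (Nat.zero_le _) (Nat.zero_le _)
      rw [matP, show (erase I).2.2 = I.2.2 from rfl, matCore_eq_false_of_le _ _ _ (not_lt.1 hk)] at this
      exact Bool.noConfusion this

/-- **Polynomial entropy approximation over `F₂` is in `promise-PH`.** [cite: Sipser1983, §V]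
[cite: DvirGutfreundRothblumVadhan2010, §3 p.6] -/
theorem PEA_mem_promiseLift_PH (d : ℕ) : PEA d ∈ promiseLift PH :=
  promiseLift_mono (SigmaP_subset_PH 2) (PEA_mem_promiseLift_SigmaP_two d)

end PEAHash

end Literature.Computability.Complexity
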